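/-
Copyright (c) 2026 the pub-hodgecm-mathlib formalisation cell (harness21).  Prover seat hodgecm-mathlib-K2E4-p10 (g5), Track B ∕ K2-LIT, h413 =
`stmt-HodgeConjecture-24833`, ENGINE E1, campaign «EIS-R7-BL» (Bernstein–Lapid soft continuation), deal «BL-P2» of the dealer K2E1-plan (g5) 2026-09-04T08:31:57Z,
RULING «(ζ′) ADOPTED» 08:34:20Z (name map: defs leaf `K2E1BLSpacesU2Defs`), spec (ζ′) WIRING `K2/K2E1b-plan/g6/WIRING-EIS-R7-BL-SPH-2.K2E1b-plan-g6.md` 7d1cceb628a30de8 §2 D1–D8;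
design memo `K2/K2E4-p10/g5/CENSUS-BL-P2-Defs.K2E4-p10-g5.md`.
-/
import Literature.NumberTheory.Automorphic.UnitaryGroupBorelTruncation                  -- ★ `borelHeight`, `borelHeight_unipotent_mul`, `adelicUnipotent`, `rationalUnipotent`, `borelConstantTerm`
import Literature.NumberTheory.Automorphic.AutomorphicRepsGLCuspidalUnitary            -- ★ `AdelicGroupData.quotFun` (the inversion descent to `automorphicQuotient`)
import Mathlib.MeasureTheory.Function.ConditionalExpectation.CondexpL2                 -- Mathlib `condExpL2` (= orthogonal projection onto `lpMeas`)
import Mathlib.MeasureTheory.Group.FundamentalDomain                                   -- Mathlib `IsFundamentalDomain`, `QuotientMeasureEqMeasurePreimage`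
import Mathlib.Analysis.InnerProductSpace.Projection.Basic
import HarnessLib

/-!
# K2·E1 — `K2E1BLSpacesU2Defs` (campaign «EIS-R7-BL», deal «BL-P2», defs leaf D1–D8): THE BERNSTEIN–LAPID SPACES ON `N(F)∖G(𝔸)` FOR MOK'S QUASI-SPLIT UNITARY GROUP —
# `Z = N(F)∖G(𝔸)`, `𝓗_k(Z_c) = L²(Z_c; H^{−2k})`, the constant-term PROJECTION `cnst_k`, `𝓗_k(𝔛; w₁^{−2k})`, `ι_{c,k}`, `π_{c,k}`, `δ_{c,c₀}(h)`, the cusp test class `𝒞_k`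

Track B ∕ K2-LIT, crux h413 = `stmt-HodgeConjecture-24833`, route of record `HCCMUnconditional`; cell `hodgecm-mathlib`, squad K2, ENGINE E1.  DEFINITIONS ONLY (`def`s with `rfl`
unfoldings; NO `instance` beyond the topology ∕ Borel σ-algebra of the NEW quotient type, NO notation, NO `sorry`); lane `--kind definition --supports stmt-HodgeConjecture-24833` (reviewed).
Closes no socket.  GENERIC in Mok's datum `quasiSplit F E c N` (ANY rank `N`: the N = 3 clone «BL-SPH-3» reuses this file verbatim — clone discipline of (ζ′) §4); the weight
exponent of Bernstein–Lapid is called `k` here (their `N`), to free the letter `N` for the rank.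

THE MATHEMATICS [BernsteinLapid2019, §4 Claims 4–5 (arXiv:1911.02342 p. 10); MoeglinWaldspurger1995, I.2.6, I.2.13; Borel1963, §5].  `G = U(J_N)` quasi-split over the number field `F`
(CM-type data `E ∕ F`, `c`), `𝔾 = G(𝔸_F)` (★ `(quasiSplit F E c N).Adelic`), `N(𝔸) ≤ 𝔾` the unipotent radical of the upper-triangular Borel (★ `adelicUnipotent`), `N(F) = N(𝔸) ∩ G(F)`
(★ `rationalUnipotent`), `H : 𝔾 → ℝ>0` the Borel height (★ `borelHeight`, left-`N(𝔸)`-invariant ★ `borelHeight_unipotent_mul`).  Bernstein–Lapid's objects (their §4, with `K_f`-level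
suppressed into the functions): the space `Z := N(F)∖𝔾` with its `𝔾`-RIGHT-invariant measure; for `c ≥ 0`, `k ∈ ℕ` the Hilbert space `𝓗_k(Z_c) := L²({H > c}; H^{−2k}·dz)` with the
restriction maps `𝓗_k(Z_c) → 𝓗_k(Z_{c₀})` (`c ≤ c₀`); the constant-term map `cnst_k` = the ORTHOGONAL PROJECTION of `𝓗_k(Z_c)` onto the closed subspace of `N(𝔸)`-invariant classes
(= fibrewise average over the compact `N(F)∖N(𝔸)` — the identification with ★ `borelConstantTerm` is the P2b theorem; here it is DEFINED as the conditional expectation w.r.t. the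
`N(𝔸)`-invariant σ-algebra, Mathlib `condExpL2`, so self-adjointness ∕ idempotence ∕ commutation with the invariant weight are structural); its kernel `𝓗_k(Z_c)^cusp`; on
`𝔛 = G(F)∖𝔾` (the tree's ★ `automorphicQuotient`, Mathlib right-coset convention, descent by inversion ★ `quotFun`) the weight `w₁(x) = sup_{γ ∈ G(F)} H(γ g)` and
`𝓗_k(𝔛) := L²(𝔛; w₁^{−2k}·dμ)`; the pull-back `ι_{c,k} : 𝓗_k(𝔛) → 𝓗_k(Z_c)` along `p_c : Z_c → 𝔛` (bounded by REDUCTION THEORY — Siegel covering multiplicity — carried as the NAMED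
letter `IotaBound`, an argument of the def), `π_{c,k} : 𝓗_k(Z_c) → 𝓗_k(𝔛)` with `ι π =` the orthogonal projection onto `range ι` (defined from the closed-range and injectivity letters of
Claim 4 bullet 1), the shifted Hecke operator `δ_{c,c₀}(h) = restr ∘ R(h)` (boundedness letter `ShiftBound`), and the cusp test class `𝒞_k` against which (Ξ₃) is typed.
CONVENTIONS.  `Z` is the LEFT orbit quotient `Quotient (MulAction.orbitRel ↥N(F) 𝔾)` — its points ARE the classes `N(F)·g`, functions on it ARE the left-`N(F)`-invariant functions of
the E1 Eisenstein files (★ `borelConstantTerm`, ★ `eisensteinSeriesU`), NO inversion; the measure on `Z` is CHARACTERISED by Mathlib's class `QuotientMeasureEqMeasurePreimage νG μZ`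
(`μZ(A) = νG(π⁻¹A ∩ 𝓕)` for EVERY fundamental domain `𝓕` of `N(F)` in `𝔾`), never constructed from a chosen `𝓕`; the ONLY inversion is in `w₁` and `p_c : [g]_{N(F)} ↦ [g⁻¹]_𝔛`,
forced by the tree's `automorphicQuotient` convention, and it makes `quotFun φ ∘ p_c = zFun φ` hold for left-`G(F)`-invariant `φ`.

* §1 D1 `ratUnipotentSubgroup`, `unipQuotient` (+ topology, Borel σ-algebra), `toUnipQuotient`, `zFun`, `unipHeight` (`HZ`), `rightShift`, `adelicUnipQuotient`, `qN`, `invariantSigma` (`mN`).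
* §2 D3 `weightedTruncMeasure`, `HN`, the restriction `restrHN` (+ `restrLin`, `toHN`).  §3 D4 `cnstN`, `HNcusp`.  §4 D5 `supHeight` (`w₁`), `HX`, `toHX`.
* §5 D6 (part 1) `pZX` (+ `quotFun_pZX`).  §7 D8 `cuspTestClass`.  THIS LEAF = D1–D5, D6 part 1, D8 (≤ 400 lines); the operator leaf `K2E1BLOperatorsU2Defs` (D6 part 2: `IotaBound`,
  `iota`, `piN`; D7: `ShiftBound`, `deltaShift` — letters-as-arguments, dealer «=» 08:41:42Z) imports this file.
D8 NOTE: «cuspidal» is typed as «zero constant term along the Borel» (★ `borelConstantTerm ν 𝓕 φ = 0`), which IS cuspidality for the rank-one data `U(1,1)`, `U(2,1)` of the campaign.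
HONEST LABEL: HC_CM is proved only modulo the 7 printed citations (2 remaining named inputs: hLiu418 = `stmt-HodgeConjecture-24832`, h413 = `stmt-HodgeConjecture-24833`) until rung 0
closes; this file defines objects, asserts no named fact and closes no socket; count-neutral.

## References
* [BernsteinLapid2019] J. Bernstein, E. Lapid, *On the meromorphic continuation of Eisenstein series*, arXiv:1911.02342 (J. Amer. Math. Soc. 2020): §4, Claims 4–5 (p. 10).
* [MoeglinWaldspurger1995] C. Mœglin, J.-L. Waldspurger, *Spectral Decomposition and Eisenstein Series* (1995): I.2.6 (constant terms), I.2.13 (weighted `L²`).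
* [Borel1963] A. Borel, *Some finiteness properties of adele groups over number fields*, Publ. IHÉS 16 (1963): §5 (Siegel sets, reduction theory).
-/

set_option autoImplicit false
set_option linter.dupNamespace false -- the mandated namespace repeats `HodgeConjecture.HodgeConjecture`

noncomputable section

open MeasureTheory NumberField IsDedekindDomain Filter Topology
open scoped NNReal ENNReal
open Literature.NumberTheory.Automorphic Literature.NumberTheory.Automorphic.UnitaryGroup AdelicGroupData

namespace Summit.HodgeConjecture.HodgeConjecture.Cruxes.H413.K2E1BLSpacesU2Defs

variable (F E : Type) [Field F] [NumberField F] [Field E] [NumberField E] [Algebra F E] (c : E ≃ₐ[F] E) (N : ℕ)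

/-! ## §1 (D1) `Z = N(F)∖G(𝔸)` as a LEFT orbit quotient, its height, its right translations, and the `N(𝔸)`-invariant σ-algebra -/

/-- **`N(F)` as a subgroup of `G(𝔸)`**: `N(𝔸) ∩ G(F)` (= the image of ★ `rationalUnipotent` under the inclusion `N(𝔸) ≤ G(𝔸)`, `ratUnipotentSubgroup_eq_map`).
[cite: BernsteinLapid2019, §4 p. 9] -/
def ratUnipotentSubgroup : Subgroup (quasiSplit F E c N).Adelic :=
  adelicUnipotent F E c N ⊓ (quasiSplit F E c N).arithmeticSubgroup

/-- `ratUnipotentSubgroup = (rationalUnipotent …).map (adelicUnipotent …).subtype`. [cite: BernsteinLapid2019, §4 p. 9] -/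
theorem ratUnipotentSubgroup_eq_map :
    ratUnipotentSubgroup F E c N = (rationalUnipotent F E c N).map (adelicUnipotent F E c N).subtype := by
  ext g
  simp only [ratUnipotentSubgroup, rationalUnipotent, Subgroup.mem_inf, Subgroup.mem_map, Subgroup.mem_comap, Subgroup.coe_subtype]
  constructor
  · rintro ⟨hN, hG⟩
    exact ⟨⟨g, hN⟩, hG, rfl⟩
  · rintro ⟨u, hu, rfl⟩
    exact ⟨u.2, hu⟩

/-- `N(F) ≤ N(𝔸)`. [cite: BernsteinLapid2019, §4 p. 9] -/
theorem ratUnipotentSubgroup_le : ratUnipotentSubgroup F E c N ≤ adelicUnipotent F E c N := inf_le_left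

/-- **`Z := N(F)∖G(𝔸)`** — the quotient of `G(𝔸)` by the LEFT multiplication action of `N(F)` (Mathlib `MulAction.orbitRel` of the subgroup acting on the group): a point is a class
`N(F)·g`, a function on `Z` is a left-`N(F)`-invariant function on `G(𝔸)` (the convention of ★ `borelConstantTerm` ∕ ★ `eisensteinSeriesU`). [cite: BernsteinLapid2019, §4 p. 9] -/
def unipQuotient : Type := Quotient (MulAction.orbitRel (ratUnipotentSubgroup F E c N) (quasiSplit F E c N).Adelic)

/-- The quotient topology on `Z`. [cite: BernsteinLapid2019, §4 p. 9] -/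
instance instTopologicalSpaceUnipQuotient : TopologicalSpace (unipQuotient F E c N) :=
  inferInstanceAs (TopologicalSpace (Quotient (MulAction.orbitRel (ratUnipotentSubgroup F E c N) (quasiSplit F E c N).Adelic)))

/-- The Borel σ-algebra on `Z` (as ★ `AdelicGroupData.instMeasurableSpaceAutomorphicQuotient`). [cite: BernsteinLapid2019, §4 p. 10] -/
instance instMeasurableSpaceUnipQuotient : MeasurableSpace (unipQuotient F E c N) := borel _

/-- The σ-algebra on `Z` is Borel by definition. [cite: BernsteinLapid2019, §4 p. 10] -/
instance instBorelSpaceUnipQuotient : BorelSpace (unipQuotient F E c N) := ⟨rfl⟩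

/-- The class map `π : G(𝔸) → Z = N(F)∖G(𝔸)`, `g ↦ N(F)·g`. [cite: BernsteinLapid2019, §4 p. 9] -/
def toUnipQuotient (g : (quasiSplit F E c N).Adelic) : unipQuotient F E c N :=
  Quotient.mk (MulAction.orbitRel (ratUnipotentSubgroup F E c N) (quasiSplit F E c N).Adelic) g

/-- `π` is continuous (quotient topology). [cite: BernsteinLapid2019, §4 p. 9] -/
theorem continuous_toUnipQuotient : Continuous (toUnipQuotient F E c N) := continuous_quotient_mk'

/-- Two elements have the same class iff they differ by an element of `N(F)` on the LEFT: `π g = π g' ↔ ∃ γ ∈ N(F), γ·g' = g`. [cite: BernsteinLapid2019, §4 p. 9] -/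
theorem toUnipQuotient_eq_iff (g g' : (quasiSplit F E c N).Adelic) :
    toUnipQuotient F E c N g = toUnipQuotient F E c N g' ↔ ∃ γ : ratUnipotentSubgroup F E c N, (γ : (quasiSplit F E c N).Adelic) * g' = g :=
  Quotient.eq.trans (MulAction.orbitRel_apply.trans MulAction.mem_orbit_iff)

/-- **The function on `Z` attached to ANY `φ : G(𝔸) → ℂ`**: `[g] ↦ φ (out [g])` (total; for left-`N(F)`-invariant `φ` it is the honest descent, `zFun_toUnipQuotient`) — the analogue of ★
`AdelicGroupData.quotFun` WITHOUT inversion. [cite: BernsteinLapid2019, §4 p. 10] -/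
def zFun (φ : (quasiSplit F E c N).Adelic → ℂ) : unipQuotient F E c N → ℂ :=
  fun z => φ (Quotient.out (z : Quotient (MulAction.orbitRel (ratUnipotentSubgroup F E c N) (quasiSplit F E c N).Adelic)))

/-- For left-`N(F)`-invariant `φ`: `zFun φ (π g) = φ g`. [cite: BernsteinLapid2019, §4 p. 10] -/
theorem zFun_toUnipQuotient {φ : (quasiSplit F E c N).Adelic → ℂ} (hφ : ∀ γ ∈ ratUnipotentSubgroup F E c N, ∀ g, φ (γ * g) = φ g)
    (g : (quasiSplit F E c N).Adelic) : zFun F E c N φ (toUnipQuotient F E c N g) = φ g := by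
  have h : toUnipQuotient F E c N (Quotient.out (toUnipQuotient F E c N g :
      Quotient (MulAction.orbitRel (ratUnipotentSubgroup F E c N) (quasiSplit F E c N).Adelic))) = toUnipQuotient F E c N g :=
    Quotient.out_eq _
  obtain ⟨γ, hγ⟩ := (toUnipQuotient_eq_iff F E c N _ _).1 h
  change φ (Quotient.out (toUnipQuotient F E c N g : Quotient (MulAction.orbitRel (ratUnipotentSubgroup F E c N) (quasiSplit F E c N).Adelic))) = φ g
  rw [← hγ]
  exact hφ _ γ.2 g

/-- `zFun` is additive (definitional). [cite: BernsteinLapid2019, §4 p. 10] -/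
theorem zFun_add (φ ψ : (quasiSplit F E c N).Adelic → ℂ) : zFun F E c N (φ + ψ) = zFun F E c N φ + zFun F E c N ψ := rfl

/-- `zFun` is homogeneous (definitional). [cite: BernsteinLapid2019, §4 p. 10] -/
theorem zFun_smul (a : ℂ) (φ : (quasiSplit F E c N).Adelic → ℂ) : zFun F E c N (a • φ) = a • zFun F E c N φ := rfl

variable [NeZero N]

/-- **The height on `Z`**: `HZ (N(F)·g) := H(g)` (well defined: `H` is left-`N(𝔸)`-invariant ★ `borelHeight_unipotent_mul`, a fortiori `N(F)`-invariant). [cite: BernsteinLapid2019, §4 p. 9] -/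
def unipHeight : unipQuotient F E c N → ℝ≥0 :=
  Quotient.lift (fun g : (quasiSplit F E c N).Adelic => borelHeight g) fun g g' (h : MulAction.orbitRel (ratUnipotentSubgroup F E c N) _ g g') => by
    obtain ⟨γ, rfl⟩ := h
    change borelHeight ((γ : (quasiSplit F E c N).Adelic) * g') = borelHeight g'
    exact borelHeight_unipotent_mul (ratUnipotentSubgroup_le F E c N γ.2) g'

/-- `HZ (π g) = H g`. [cite: BernsteinLapid2019, §4 p. 9] -/
theorem unipHeight_toUnipQuotient (g : (quasiSplit F E c N).Adelic) : unipHeight F E c N (toUnipQuotient F E c N g) = borelHeight g := rfl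

omit [NeZero N] in
/-- **Right translation on `Z`**: `[g] ↦ [g·y]` for `y ∈ G(𝔸)` (left `N(F)`-classes are preserved by right multiplication) — Bernstein–Lapid's `δ(h) = R(h)` acts through it.
[cite: BernsteinLapid2019, §4 p. 10] -/
def rightShift (y : (quasiSplit F E c N).Adelic) : unipQuotient F E c N → unipQuotient F E c N :=
  Quotient.lift (fun g : (quasiSplit F E c N).Adelic => toUnipQuotient F E c N (g * y))
    fun g g' (h : MulAction.orbitRel (ratUnipotentSubgroup F E c N) _ g g') => by
      obtain ⟨γ, rfl⟩ := h
      exact (toUnipQuotient_eq_iff F E c N _ _).2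
        ⟨γ, by change (γ : (quasiSplit F E c N).Adelic) * (g' * y) = (γ : (quasiSplit F E c N).Adelic) * g' * y; rw [mul_assoc]⟩

omit [NeZero N] in
/-- `rightShift y` is continuous. [cite: BernsteinLapid2019, §4 p. 10] -/
theorem continuous_rightShift (y : (quasiSplit F E c N).Adelic) : Continuous (rightShift F E c N y) :=
  ((continuous_toUnipQuotient F E c N).comp (continuous_id.mul continuous_const)).quotient_lift _

omit [NeZero N] in
/-- `rightShift y (π g) = π (g·y)`. [cite: BernsteinLapid2019, §4 p. 10] -/
theorem rightShift_toUnipQuotient (y g : (quasiSplit F E c N).Adelic) : rightShift F E c N y (toUnipQuotient F E c N g) = toUnipQuotient F E c N (g * y) := rfl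

omit [NeZero N] in
/-- **`N(𝔸)∖G(𝔸)`** — the quotient by the full adelic unipotent radical (the base of the compact fibration `Z → N(𝔸)∖G(𝔸)` with fibre `N(F)∖N(𝔸)`); used ONLY to name the
`N(𝔸)`-invariant σ-algebra on `Z`. [cite: BernsteinLapid2019, §4 p. 10] -/
def adelicUnipQuotient : Type := Quotient (MulAction.orbitRel (adelicUnipotent F E c N) (quasiSplit F E c N).Adelic)

omit [NeZero N] in
/-- The quotient topology on `N(𝔸)∖G(𝔸)`. [cite: BernsteinLapid2019, §4 p. 10] -/
instance instTopologicalSpaceAdelicUnipQuotient : TopologicalSpace (adelicUnipQuotient F E c N) :=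
  inferInstanceAs (TopologicalSpace (Quotient (MulAction.orbitRel (adelicUnipotent F E c N) (quasiSplit F E c N).Adelic)))

omit [NeZero N] in
/-- **`qN : Z → N(𝔸)∖G(𝔸)`**, `N(F)·g ↦ N(𝔸)·g` (well defined since `N(F) ≤ N(𝔸)`). [cite: BernsteinLapid2019, §4 p. 10] -/
def qN : unipQuotient F E c N → adelicUnipQuotient F E c N :=
  Quotient.lift (fun g : (quasiSplit F E c N).Adelic => (Quotient.mk (MulAction.orbitRel (adelicUnipotent F E c N) (quasiSplit F E c N).Adelic) g : adelicUnipQuotient F E c N))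
    fun g g' (h : MulAction.orbitRel (ratUnipotentSubgroup F E c N) _ g g') => by
      obtain ⟨γ, rfl⟩ := h
      exact Quotient.sound ⟨⟨(γ : (quasiSplit F E c N).Adelic), ratUnipotentSubgroup_le F E c N γ.2⟩, rfl⟩

omit [NeZero N] in
/-- `qN` is continuous. [cite: BernsteinLapid2019, §4 p. 10] -/
theorem continuous_qN : Continuous (qN F E c N) :=
  (continuous_quotient_mk' : Continuous fun g : (quasiSplit F E c N).Adelic =>
    (Quotient.mk (MulAction.orbitRel (adelicUnipotent F E c N) (quasiSplit F E c N).Adelic) g : adelicUnipQuotient F E c N)).quotient_lift _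

omit [NeZero N] in
/-- **The `N(𝔸)`-invariant σ-algebra `mN` on `Z`**: the pull-back of the Borel σ-algebra of `N(𝔸)∖G(𝔸)` along `qN` — its measurable functions are the functions of the `N(𝔸)`-orbit
(«functions of `(H, k)`-coordinates»), the range of the constant-term projection. [cite: BernsteinLapid2019, §4 Claim 4 p. 10] -/
@[reducible] def invariantSigma : MeasurableSpace (unipQuotient F E c N) :=
  MeasurableSpace.comap (qN F E c N) (borel (adelicUnipQuotient F E c N))

omit [NeZero N] in
/-- `mN ≤` the Borel σ-algebra of `Z` (`qN` is continuous). [cite: BernsteinLapid2019, §4 Claim 4 p. 10] -/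
theorem invariantSigma_le : invariantSigma F E c N ≤ (instMeasurableSpaceUnipQuotient F E c N : MeasurableSpace (unipQuotient F E c N)) := by
  letI : MeasurableSpace (adelicUnipQuotient F E c N) := borel _
  haveI : BorelSpace (adelicUnipQuotient F E c N) := ⟨rfl⟩
  exact (continuous_qN F E c N).measurable.comap_le

/-! ## §2 (D3) `𝓗_k(Z_c) = L²({c < HZ}; HZ^{−2k}·dμZ)` and the restriction `𝓗_k(Z_c) → 𝓗_k(Z_{c₀})` -/

/-- **The weighted truncated measure `HZ^{−2k}·μZ|_{Z_c}`**, `Z_c = {z : c < HZ z}`, for a measure `μZ` on `Z` (in the applications `[QuotientMeasureEqMeasurePreimage νG μZ]` for a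
Haar measure `νG` of `G(𝔸)`). [cite: BernsteinLapid2019, §4 p. 10] [cite: MoeglinWaldspurger1995, I.2.13] -/
def weightedTruncMeasure (k : ℕ) (c₁ : ℝ≥0) (μZ : Measure (unipQuotient F E c N)) : Measure (unipQuotient F E c N) :=
  (μZ.restrict {z | c₁ < unipHeight F E c N z}).withDensity fun z => (((unipHeight F E c N z)⁻¹ ^ (2 * k) : ℝ≥0) : ℝ≥0∞)

/-- **`𝓗_k(Z_c) := L²(Z; HZ^{−2k}·μZ|_{Z_c})`** — Bernstein–Lapid's Hilbert space (the subspace «supported in `Z_c`» of `L²(Z, H^{−2k})` is realised as `L²` of the restricted measure).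
[cite: BernsteinLapid2019, §4 p. 10] [cite: MoeglinWaldspurger1995, I.2.13] -/
abbrev HN (k : ℕ) (c₁ : ℝ≥0) (μZ : Measure (unipQuotient F E c N)) : Type :=
  Lp ℂ 2 (weightedTruncMeasure F E c N k c₁ μZ)

/-- The truncated weighted measures decrease in `c`: `μ_{k,c₀} ≤ μ_{k,c}` for `c ≤ c₀`. [cite: BernsteinLapid2019, §4 p. 10] -/
theorem weightedTruncMeasure_mono (k : ℕ) {c₁ c₀ : ℝ≥0} (h : c₁ ≤ c₀) (μZ : Measure (unipQuotient F E c N)) :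
    weightedTruncMeasure F E c N k c₀ μZ ≤ weightedTruncMeasure F E c N k c₁ μZ := by
  have hle : μZ.restrict {z | c₀ < unipHeight F E c N z} ≤ μZ.restrict {z | c₁ < unipHeight F E c N z} :=
    Measure.restrict_mono (fun z (hz : c₀ < unipHeight F E c N z) => lt_of_le_of_lt h hz) le_rfl
  refine Measure.le_iff.2 fun s hs => ?_
  rw [weightedTruncMeasure, weightedTruncMeasure, withDensity_apply _ hs, withDensity_apply _ hs]
  exact lintegral_mono' (Measure.restrict_mono subset_rfl hle) le_rfl

/-- The truncated weighted measures are dominated: `μ_{k,c₀} ≪ μ_{k,c}` for `c ≤ c₀`. [cite: BernsteinLapid2019, §4 p. 10] -/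
theorem weightedTruncMeasure_absolutelyContinuous (k : ℕ) {c₁ c₀ : ℝ≥0} (h : c₁ ≤ c₀) (μZ : Measure (unipQuotient F E c N)) :
    weightedTruncMeasure F E c N k c₀ μZ ≪ weightedTruncMeasure F E c N k c₁ μZ :=
  Measure.absolutelyContinuous_of_le (weightedTruncMeasure_mono F E c N k h μZ)

/-- An element of `𝓗_k(Z_c)` restricts to `𝓗_k(Z_{c₀})` (`c ≤ c₀`): `MemLp` for the smaller measure. [cite: BernsteinLapid2019, §4 p. 10] -/
theorem memLp_restrict (k : ℕ) {c₁ c₀ : ℝ≥0} (h : c₁ ≤ c₀) (μZ : Measure (unipQuotient F E c N)) (f : HN F E c N k c₁ μZ) :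
    MemLp (f : unipQuotient F E c N → ℂ) 2 (weightedTruncMeasure F E c N k c₀ μZ) :=
  (Lp.memLp f).mono_measure (weightedTruncMeasure_mono F E c N k h μZ)

/-- **The restriction `𝓗_k(Z_c) → 𝓗_k(Z_{c₀})` (`c ≤ c₀`) as a LINEAR map** (the class of the same function for the smaller measure). [cite: BernsteinLapid2019, §4 Claim 4 p. 10] -/
def restrLin (k : ℕ) {c₁ c₀ : ℝ≥0} (h : c₁ ≤ c₀) (μZ : Measure (unipQuotient F E c N)) : HN F E c N k c₁ μZ →ₗ[ℂ] HN F E c N k c₀ μZ where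
  toFun f := (memLp_restrict F E c N k h μZ f).toLp (f : unipQuotient F E c N → ℂ)
  map_add' f g := by
    rw [← MemLp.toLp_add (memLp_restrict F E c N k h μZ f) (memLp_restrict F E c N k h μZ g)]
    exact MemLp.toLp_congr _ _ ((weightedTruncMeasure_absolutelyContinuous F E c N k h μZ).ae_le (Lp.coeFn_add f g))
  map_smul' a f := by
    rw [RingHom.id_apply, ← MemLp.toLp_const_smul]
    exact MemLp.toLp_congr _ _ ((weightedTruncMeasure_absolutelyContinuous F E c N k h μZ).ae_le (Lp.coeFn_smul a f))

/-- The restriction does not increase the norm: `‖f|_{Z_{c₀}}‖ ≤ ‖f‖`. [cite: BernsteinLapid2019, §4 Claim 4 p. 10] -/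
theorem norm_restrLin_le (k : ℕ) {c₁ c₀ : ℝ≥0} (h : c₁ ≤ c₀) (μZ : Measure (unipQuotient F E c N)) (f : HN F E c N k c₁ μZ) :
    ‖restrLin F E c N k h μZ f‖ ≤ ‖f‖ := by
  rw [restrLin, LinearMap.coe_mk, AddHom.coe_mk, Lp.norm_toLp, Lp.norm_def]
  exact ENNReal.toReal_mono (Lp.eLpNorm_ne_top f) (eLpNorm_mono_measure _ (weightedTruncMeasure_mono F E c N k h μZ))

/-- **`restr : 𝓗_k(Z_c) →L 𝓗_k(Z_{c₀})`** (`c ≤ c₀`), the bounded restriction map of Claim 4 (norm `≤ 1`). [cite: BernsteinLapid2019, §4 Claim 4 p. 10] -/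
def restrHN (k : ℕ) {c₁ c₀ : ℝ≥0} (h : c₁ ≤ c₀) (μZ : Measure (unipQuotient F E c N)) : HN F E c N k c₁ μZ →L[ℂ] HN F E c N k c₀ μZ :=
  (restrLin F E c N k h μZ).mkContinuous 1 fun f => by rw [one_mul]; exact norm_restrLin_le F E c N k h μZ f

/-- Unfolding: `restrHN h f` is the class of `⇑f` for the smaller measure. [cite: BernsteinLapid2019, §4 Claim 4 p. 10] -/
theorem restrHN_apply (k : ℕ) {c₁ c₀ : ℝ≥0} (h : c₁ ≤ c₀) (μZ : Measure (unipQuotient F E c N)) (f : HN F E c N k c₁ μZ) :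
    restrHN F E c N k h μZ f = (memLp_restrict F E c N k h μZ f).toLp (f : unipQuotient F E c N → ℂ) := rfl

/-- **`toHN`**: the class in `𝓗_k(Z_c)` of a left-`N(F)`-invariant function `φ` on `G(𝔸)` (through ★ `zFun`), given the square-integrability `hφ` — the bridge the analytic files use
(K1-L², P6, P7). [cite: BernsteinLapid2019, §4 p. 10] [cite: MoeglinWaldspurger1995, I.2.13] -/
def toHN (k : ℕ) (c₁ : ℝ≥0) (μZ : Measure (unipQuotient F E c N)) (φ : (quasiSplit F E c N).Adelic → ℂ)
    (hφ : MemLp (zFun F E c N φ) 2 (weightedTruncMeasure F E c N k c₁ μZ)) : HN F E c N k c₁ μZ :=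
  hφ.toLp (zFun F E c N φ)

/-- `toHN φ =ᵐ zFun φ`. [cite: BernsteinLapid2019, §4 p. 10] -/
theorem coeFn_toHN (k : ℕ) (c₁ : ℝ≥0) (μZ : Measure (unipQuotient F E c N)) (φ : (quasiSplit F E c N).Adelic → ℂ)
    (hφ : MemLp (zFun F E c N φ) 2 (weightedTruncMeasure F E c N k c₁ μZ)) :
    (toHN F E c N k c₁ μZ φ hφ : unipQuotient F E c N → ℂ) =ᵐ[weightedTruncMeasure F E c N k c₁ μZ] zFun F E c N φ :=
  hφ.coeFn_toLp

/-! ## §3 (D4) The constant-term PROJECTION `cnst_k` on `𝓗_k(Z_c)` and the cuspidal part `𝓗_k(Z_c)^cusp` -/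

/-- **`cnst_k : 𝓗_k(Z_c) →L 𝓗_k(Z_c)` — THE CONSTANT-TERM MAP AS AN ORTHOGONAL PROJECTION**: the conditional expectation with respect to the `N(𝔸)`-invariant σ-algebra `mN` (Mathlib
`condExpL2` = `orthogonalProjectionOnto (lpMeas …)` BY DEFINITION), followed by the inclusion of `lpMeas`.  Its range is the closed subspace of classes of `N(𝔸)`-invariant functions
(«functions of the `(H, k)`-coordinates», Claim 4 bullet 4); self-adjointness, idempotence, and commutation with the `mN`-measurable weight `HZ^{−2k}` and with `restrHN` are structural;
the identification with the fibrewise average `(ν𝓕)⁻¹∫_𝓕 φ(u·g) dν(u)` (★ `borelConstantTerm`) over the compact `N(F)∖N(𝔸)` is the theorem of P2b (disintegration of `μZ` along `qN`).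
[cite: BernsteinLapid2019, §4 Claim 4 p. 10] [cite: MoeglinWaldspurger1995, I.2.6] -/
def cnstN (k : ℕ) (c₁ : ℝ≥0) (μZ : Measure (unipQuotient F E c N)) : HN F E c N k c₁ μZ →L[ℂ] HN F E c N k c₁ μZ :=
  (lpMeas ℂ ℂ (invariantSigma F E c N) 2 (weightedTruncMeasure F E c N k c₁ μZ)).subtypeL.comp
    (condExpL2 ℂ ℂ (μ := weightedTruncMeasure F E c N k c₁ μZ) (invariantSigma_le F E c N))

/-- Unfolding: `cnstN f = ↑(condExpL2 ℂ ℂ hmN f)`. [cite: BernsteinLapid2019, §4 Claim 4 p. 10] -/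
theorem cnstN_apply (k : ℕ) (c₁ : ℝ≥0) (μZ : Measure (unipQuotient F E c N)) (f : HN F E c N k c₁ μZ) :
    cnstN F E c N k c₁ μZ f = ((condExpL2 ℂ ℂ (μ := weightedTruncMeasure F E c N k c₁ μZ) (invariantSigma_le F E c N) f :
      lpMeas ℂ ℂ (invariantSigma F E c N) 2 (weightedTruncMeasure F E c N k c₁ μZ)) : HN F E c N k c₁ μZ) := rfl

/-- The range of `cnst_k` lies in the `N(𝔸)`-invariant classes (`lpMeas` of `mN`). [cite: BernsteinLapid2019, §4 Claim 4 p. 10] -/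
theorem cnstN_mem_lpMeas (k : ℕ) (c₁ : ℝ≥0) (μZ : Measure (unipQuotient F E c N)) (f : HN F E c N k c₁ μZ) :
    cnstN F E c N k c₁ μZ f ∈ lpMeas ℂ ℂ (invariantSigma F E c N) 2 (weightedTruncMeasure F E c N k c₁ μZ) :=
  (condExpL2 ℂ ℂ (μ := weightedTruncMeasure F E c N k c₁ μZ) (invariantSigma_le F E c N) f).2

/-- **`𝓗_k(Z_c)^cusp := ker cnst_k`** — the classes with zero constant term (a closed subspace). [cite: BernsteinLapid2019, §4 Claim 5 p. 10] -/
def HNcusp (k : ℕ) (c₁ : ℝ≥0) (μZ : Measure (unipQuotient F E c N)) : Submodule ℂ (HN F E c N k c₁ μZ) :=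
  LinearMap.ker (cnstN F E c N k c₁ μZ).toLinearMap

/-- Membership in `𝓗_k(Z_c)^cusp` unfolded. [cite: BernsteinLapid2019, §4 Claim 5 p. 10] -/
theorem mem_HNcusp_iff (k : ℕ) (c₁ : ℝ≥0) (μZ : Measure (unipQuotient F E c N)) (f : HN F E c N k c₁ μZ) :
    f ∈ HNcusp F E c N k c₁ μZ ↔ cnstN F E c N k c₁ μZ f = 0 :=
  LinearMap.mem_ker

/-- `𝓗_k(Z_c)^cusp` is closed. [cite: BernsteinLapid2019, §4 Claim 5 p. 10] -/
theorem isClosed_HNcusp (k : ℕ) (c₁ : ℝ≥0) (μZ : Measure (unipQuotient F E c N)) : IsClosed (HNcusp F E c N k c₁ μZ : Set (HN F E c N k c₁ μZ)) :=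
  (cnstN F E c N k c₁ μZ).isClosed_ker

/-! ## §4 (D5) The weight `w₁` on `𝔛 = G(F)∖G(𝔸)` (the tree's ★ `automorphicQuotient`) and `𝓗_k(𝔛; w₁^{−2k})` -/

/-- **`w₁(x) := sup_{γ ∈ G(F)} H(γ · g⁻¹)`** for `x = [g] ∈ automorphicQuotient = G(𝔸) ⧸ G(F)` (Mathlib convention, hence the inversion, matching ★ `AdelicGroupData.quotFun`;
well defined on cosets `g·G(F)` since `(g γ₀)⁻¹ = γ₀⁻¹ g⁻¹` re-indexes `γ`); the supremum in `ℝ≥0` (finite and attained by reduction theory — P2a; `⨆` of an unbounded family is the junk `0`).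
[cite: BernsteinLapid2019, §4 p. 10] [cite: Borel1963, §5] -/
def supHeight (x : (quasiSplit F E c N).automorphicQuotient) : ℝ≥0 :=
  ⨆ γ : (quasiSplit F E c N).Rational, borelHeight ((quasiSplit F E c N).toAdelic γ * (Quotient.out (x : (quasiSplit F E c N).Adelic ⧸ (quasiSplit F E c N).quotientSubgroup))⁻¹)

/-- **`𝓗_k(𝔛) := L²(𝔛; w₁^{−2k}·μ)`** for an automorphic measure `μ` (`[IsAutomorphicMeasure μ]` in the applications). [cite: BernsteinLapid2019, §4 p. 10] [cite: MoeglinWaldspurger1995, I.2.13] -/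
abbrev HX (k : ℕ) (μ : Measure (quasiSplit F E c N).automorphicQuotient) : Type :=
  Lp ℂ 2 (μ.withDensity fun x => (((supHeight F E c N x)⁻¹ ^ (2 * k) : ℝ≥0) : ℝ≥0∞))

/-- **`toHX`**: the class in `𝓗_k(𝔛)` of a left-`G(F)`-invariant function `φ` on `G(𝔸)` (through ★ `quotFun`), given square-integrability against `w₁^{−2k}` (P7: the spherical Eisenstein
series for `k ≥ ⌈Re z⌉ + 1`). [cite: BernsteinLapid2019, §4 p. 10] [cite: MoeglinWaldspurger1995, I.2.13] -/
def toHX (k : ℕ) (μ : Measure (quasiSplit F E c N).automorphicQuotient) (φ : (quasiSplit F E c N).Adelic → ℂ)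
    (hφ : MemLp ((quasiSplit F E c N).quotFun φ) 2 (μ.withDensity fun x => (((supHeight F E c N x)⁻¹ ^ (2 * k) : ℝ≥0) : ℝ≥0∞))) : HX F E c N k μ :=
  hφ.toLp ((quasiSplit F E c N).quotFun φ)

/-! ## §5 (D6, part 1) The projection `p : Z → 𝔛`, `N(F)·g ↦ [g⁻¹]` -/

omit [NeZero N] in
/-- **`pZX : Z → 𝔛`, `N(F)·g ↦ [g⁻¹]`** (well defined: `(γg)⁻¹ = g⁻¹γ⁻¹ ∈ g⁻¹·G(F)` for `γ ∈ N(F) ≤ G(F)`).  The inversion meets the tree's `automorphicQuotient` convention, so that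
`quotFun φ ∘ pZX = zFun φ` on left-`G(F)`-invariant `φ` (`quotFun_pZX`). [cite: BernsteinLapid2019, §4 p. 10] -/
def pZX : unipQuotient F E c N → (quasiSplit F E c N).automorphicQuotient :=
  Quotient.lift (fun g : (quasiSplit F E c N).Adelic => (quasiSplit F E c N).toAutomorphicQuotient g⁻¹)
    fun g g' (h : MulAction.orbitRel (ratUnipotentSubgroup F E c N) _ g g') => by
      obtain ⟨γ, rfl⟩ := h
      change ((QuotientGroup.mk ((γ : (quasiSplit F E c N).Adelic) * g')⁻¹ : (quasiSplit F E c N).Adelic ⧸ (quasiSplit F E c N).quotientSubgroup)) =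
        QuotientGroup.mk g'⁻¹
      rw [QuotientGroup.eq, inv_inv, mul_inv_cancel_right]
      exact (quasiSplit F E c N).arithmeticSubgroup_le_quotientSubgroup γ.2.2

omit [NeZero N] in
/-- `pZX (π g) = [g⁻¹]`. [cite: BernsteinLapid2019, §4 p. 10] -/
theorem pZX_toUnipQuotient (g : (quasiSplit F E c N).Adelic) : pZX F E c N (toUnipQuotient F E c N g) = (quasiSplit F E c N).toAutomorphicQuotient g⁻¹ := rfl

omit [NeZero N] in
/-- `pZX` is continuous. [cite: BernsteinLapid2019, §4 p. 10] -/
theorem continuous_pZX : Continuous (pZX F E c N) :=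
  ((quasiSplit F E c N).continuous_toAutomorphicQuotient.comp continuous_inv).quotient_lift _

omit [NeZero N] in
/-- **Pull-backs of automorphic functions are the same functions on representatives**: `quotFun φ (pZX (π g)) = φ g` for `φ` left-`G(F)`-invariant (★ `quotFun_toAutomorphicQuotient`,
`(g⁻¹)⁻¹ = g`). [cite: BernsteinLapid2019, §4 p. 10] -/
theorem quotFun_pZX {φ : (quasiSplit F E c N).Adelic → ℂ} (hφ : ∀ γ ∈ (quasiSplit F E c N).quotientSubgroup, ∀ g, φ (γ * g) = φ g) (g : (quasiSplit F E c N).Adelic) :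
    (quasiSplit F E c N).quotFun φ (pZX F E c N (toUnipQuotient F E c N g)) = φ g := by
  rw [pZX_toUnipQuotient, AdelicGroupData.quotFun_toAutomorphicQuotient hφ, inv_inv]

/-! ## §7 (D8) The cusp test class `𝒞_k` -/

/-- **The cusp test class `𝒞_k(μ)`**: functions `φ` on `G(𝔸)`, left-`G(F)`-invariant, CUSPIDAL along the Borel (`borelConstantTerm ν 𝓕 φ = 0`), whose descent `quotFun φ` is square
integrable against BOTH `μ` and the weight `w₁^{2k}` (so that the pairing `⟨ψ, φ⟩_μ` with any `ψ ∈ 𝓗_k(𝔛)` converges) — the class against which (Ξ₃) «`ψ ⊥ 𝒞_k`» is typed ((ζ′) §3 P6: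
not `L²_cusp`). [cite: BernsteinLapid2019, §4 Claim 2 p. 9] [cite: MoeglinWaldspurger1995, I.2.18] -/
def cuspTestClass (k : ℕ) [MeasurableSpace (adelicUnipotent F E c N)] (ν : Measure (adelicUnipotent F E c N)) (𝓕 : Set (adelicUnipotent F E c N))
    (μ : Measure (quasiSplit F E c N).automorphicQuotient) : Set ((quasiSplit F E c N).Adelic → ℂ) :=
  {φ | (∀ γ ∈ (quasiSplit F E c N).quotientSubgroup, ∀ g, φ (γ * g) = φ g) ∧ (∀ g, borelConstantTerm ν 𝓕 φ g = 0) ∧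
    MemLp ((quasiSplit F E c N).quotFun φ) 2 μ ∧
    MemLp (fun x => ((supHeight F E c N x : ℝ) ^ (2 * k) : ℂ) * (quasiSplit F E c N).quotFun φ x) 2 μ}

/-- Membership in `𝒞_k` unfolded. [cite: BernsteinLapid2019, §4 Claim 2 p. 9] -/
theorem mem_cuspTestClass_iff (k : ℕ) [MeasurableSpace (adelicUnipotent F E c N)] (ν : Measure (adelicUnipotent F E c N)) (𝓕 : Set (adelicUnipotent F E c N))
    (μ : Measure (quasiSplit F E c N).automorphicQuotient) (φ : (quasiSplit F E c N).Adelic → ℂ) :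
    φ ∈ cuspTestClass F E c N k ν 𝓕 μ ↔
      (∀ γ ∈ (quasiSplit F E c N).quotientSubgroup, ∀ g, φ (γ * g) = φ g) ∧ (∀ g, borelConstantTerm ν 𝓕 φ g = 0) ∧
        MemLp ((quasiSplit F E c N).quotFun φ) 2 μ ∧
        MemLp (fun x => ((supHeight F E c N x : ℝ) ^ (2 * k) : ℂ) * (quasiSplit F E c N).quotFun φ x) 2 μ :=
  Iff.rfl

end Summit.HodgeConjecture.HodgeConjecture.Cruxes.H413.K2E1BLSpacesU2Defs

end
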